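import Summits.AtomisticToContinuum.FouriersLaw.Theorems.OddSectorIrreversibilityConeScaleCorrectorStubHorizonCorrectorMemLp
import Summits.AtomisticToContinuum.FouriersLaw.Theorems.OddResponseBound.Negative.OddPairing
import Mathlib.MeasureTheory.Integral.Prod

/-!
# `ConeScaleCorrector` (E1), line `GlueInnerCone`: stub `stub_minkowskiInTime`

Registered stub of crux stmt-AtomisticToContinuum-14069 (fixed `N`, bookkeeping): Minkowski's integral
inequality in time for the forecast curve `t ↦ P_tJ_tot` of the equilibrium pinned chain in `L²(μ_T)`,
`‖u_S − u_A‖_{L²(μ_T)} ≤ ∫_{(A,S]} ‖P_tJ_tot‖_{L²(μ_T)} dt` for `0 ≤ A ≤ S`, where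
`u_S = ∫_{(0,S]} P_tJ_tot dt`, `μ_T = e^{-H_N/T}·Lebesgue` is `OddSectorLocality.gibbsWeight`,
`P_tJ_tot = OddSectorLocality.currentForecast` and `‖P_tJ_tot‖² = OddSectorLocality.forecastNormSq`,
whenever `t ↦ ‖P_tJ_tot‖` is integrable on `(A,S]`.

Route (duality; no `L²`-valued Bochner integrals).
* `sqrt_integral_sq_integral_le` — the abstract inequality: for a jointly measurable `F : Y → X → ℝ`
  (`ν` finite on `Y`, `μ` s-finite on `X`) dominated by `|F y ·| ≤ B ∈ L²(μ)`,
  `√(∫ (∫ F y x dν)² dμ) ≤ ∫ √(∫ (F y x)² dμ) dν`. With `φ = ∫ F y · dν ∈ L²(μ)`: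
  `∫ φ² dμ = ∫ (∫ φ F_y dμ) dν` (Fubini; the integrand is dominated by `ν(Y)·B(x)²`), then
  Cauchy–Schwarz (`sq_integral_mul_le`) at each `y`, and division by `‖φ‖`.
* `stub_minkowskiInTime` — `F = currentForecast`, `ν = Lebesgue|_{(A,S]}`: joint measurability is
  `pinnedChain_stronglyMeasurable_act_uncurry`; the `t`-uniform weighted bound
  `|P_tJ(z)| ≤ (|μ_T J| + KC) e^{ϑH(z)}`, `ϑ = 1/(4T)` (`pinnedChain_abs_act_le`, Harris constants from
  `pinnedChain_harris_bound`) with `e^{2ϑH} ∈ L¹(μ_T)` gives the `L²` dominator; and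
  `u_S − u_A = ∫_{(A,S]} P_tJ dt` pointwise because `t ↦ P_tJ(z)` is integrable on `(0,∞)`
  (`centred_integrableOn_act`). `N = 0`: `J ≡ 0` and both sides are trivial.
-/

noncomputable section

open MeasureTheory Filter Topology Set
open scoped ENNReal NNReal BigOperators
open Literature.MathematicalPhysics.KineticTheory.HeatConduction
open Literature.MathematicalPhysics.KineticTheory.OddSectorLocality
open Summit.AtomisticToContinuum.FouriersLaw.Theorems.OddResponseBound.Negative.OddPairing

namespace Summit.AtomisticToContinuum.FouriersLaw.Theorems.OddSectorIrreversibility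

open Summit.AtomisticToContinuum.FouriersLaw.Theorems.LightConeBondHeat

/-! ### Minkowski's integral inequality in `L²`, by duality -/

/-- **Minkowski's integral inequality in `L²` (dominated form).** For `F : Y → X → ℝ` jointly
measurable, `ν` finite, `μ` s-finite, `|F y x| ≤ B x` with `B ∈ L²(μ)`, and
`y ↦ ‖F y‖_{L²(μ)}` `ν`-integrable:
`√(∫ (∫ F y x dν(y))² dμ(x)) ≤ ∫ √(∫ (F y x)² dμ(x)) dν(y)`.
Proof by duality: with `φ = ∫ F y · dν`, `∫ φ² dμ = ∫ (∫ φ·F y dμ) dν ≤ ‖φ‖ ∫ ‖F y‖ dν`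
(Fubini and Cauchy–Schwarz). [folklore] -/
theorem sqrt_integral_sq_integral_le {X Y : Type*} [MeasurableSpace X] [MeasurableSpace Y]
    {μ : Measure X} {ν : Measure Y} [SFinite μ] [IsFiniteMeasure ν]
    {F : Y → X → ℝ} {B : X → ℝ} (hF : StronglyMeasurable (Function.uncurry F))
    (hB : MemLp B 2 μ) (hFB : ∀ y x, |F y x| ≤ B x)
    (hint : Integrable (fun y => Real.sqrt (∫ x, (F y x) ^ 2 ∂μ)) ν) :
    Real.sqrt (∫ x, (∫ y, F y x ∂ν) ^ 2 ∂μ) ≤ ∫ y, Real.sqrt (∫ x, (F y x) ^ 2 ∂μ) ∂ν := by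
  -- measurability of `φ = ∫ F y · dν` and of the sections `F y`
  have hφm : StronglyMeasurable fun x => ∫ y, F y x ∂ν := hF.integral_prod_left
  have hFy : ∀ y, MemLp (F y) 2 μ := fun y =>
    hB.of_le (hF.comp_measurable measurable_prodMk_left).aestronglyMeasurable
      (Eventually.of_forall fun x => by
        rw [Real.norm_eq_abs, Real.norm_eq_abs]
        exact (hFB y x).trans (le_abs_self _))
  -- `|φ| ≤ ν(Y)·|B|`, so `φ ∈ L²(μ)`
  have hφb : ∀ x, |∫ y, F y x ∂ν| ≤ ν.real univ * |B x| := fun x => by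
    have h := norm_integral_le_of_norm_le_const (μ := ν) (f := fun y => F y x) (C := B x)
      (Eventually.of_forall fun y => by rw [Real.norm_eq_abs]; exact hFB y x)
    rw [Real.norm_eq_abs, mul_comm] at h
    exact h.trans (mul_le_mul_of_nonneg_left (le_abs_self _) measureReal_nonneg)
  have hφ : MemLp (fun x => ∫ y, F y x ∂ν) 2 μ :=
    hB.of_le_mul hφm.aestronglyMeasurable (Eventually.of_forall fun x => by
      rw [Real.norm_eq_abs, Real.norm_eq_abs]; exact hφb x)
  -- the pairing integrand `(x, y) ↦ φ(x)·F(y, x)` is integrable on `μ ⊗ ν` (dominated by `ν(Y)·B²`)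
  have hG : Integrable (Function.uncurry fun x y => (∫ y', F y' x ∂ν) * F y x) (μ.prod ν) := by
    refine Integrable.mono'
      ((hB.integrable_sq.const_mul (ν.real univ)).mul_prod (integrable_const (1 : ℝ)))
      ((hφm.comp_measurable measurable_fst).mul
        (hF.comp_measurable measurable_swap)).aestronglyMeasurable
      (Eventually.of_forall fun p => ?_)
    obtain ⟨x, y⟩ := p
    simp only [Function.uncurry_apply_pair, Real.norm_eq_abs, abs_mul, mul_one]
    calc |∫ y', F y' x ∂ν| * |F y x| ≤ ν.real univ * |B x| * |B x| :=
          mul_le_mul (hφb x) ((hFB y x).trans (le_abs_self _)) (abs_nonneg _)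
            (mul_nonneg measureReal_nonneg (abs_nonneg _))
      _ = ν.real univ * B x ^ 2 := by rw [mul_assoc, ← sq, sq_abs]
  -- Cauchy–Schwarz at each `y`
  have hA0 : 0 ≤ ∫ x, (∫ y, F y x ∂ν) ^ 2 ∂μ := integral_nonneg fun x => sq_nonneg _
  have hCS : ∀ y, ∫ x, (∫ y', F y' x ∂ν) * F y x ∂μ ≤
      Real.sqrt (∫ x, (∫ y', F y' x ∂ν) ^ 2 ∂μ) * Real.sqrt (∫ x, (F y x) ^ 2 ∂μ) := fun y => by
    have h1 := Real.abs_le_sqrt (sq_integral_mul_le hφ (hFy y))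
    rw [Real.sqrt_mul hA0] at h1
    exact (le_abs_self _).trans h1
  -- `∫ φ² dμ = ∫ (∫ φ·F y dμ) dν ≤ ‖φ‖ · ∫ ‖F y‖ dν`
  have hmain : ∫ x, (∫ y, F y x ∂ν) ^ 2 ∂μ ≤
      Real.sqrt (∫ x, (∫ y, F y x ∂ν) ^ 2 ∂μ) * ∫ y, Real.sqrt (∫ x, (F y x) ^ 2 ∂μ) ∂ν := by
    calc ∫ x, (∫ y, F y x ∂ν) ^ 2 ∂μ = ∫ x, (∫ y, (∫ y', F y' x ∂ν) * F y x ∂ν) ∂μ := by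
          congr 1; funext x; rw [integral_const_mul, sq]
      _ = ∫ y, (∫ x, (∫ y', F y' x ∂ν) * F y x ∂μ) ∂ν := integral_integral_swap hG
      _ ≤ ∫ y, Real.sqrt (∫ x, (∫ y', F y' x ∂ν) ^ 2 ∂μ) * Real.sqrt (∫ x, (F y x) ^ 2 ∂μ) ∂ν :=
          integral_mono hG.integral_prod_right (hint.const_mul _) hCS
      _ = _ := integral_const_mul _ _
  -- divide by `‖φ‖`
  have hI0 : 0 ≤ ∫ y, Real.sqrt (∫ x, (F y x) ^ 2 ∂μ) ∂ν :=
    integral_nonneg fun y => Real.sqrt_nonneg _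
  rcases (Real.sqrt_nonneg (∫ x, (∫ y, F y x ∂ν) ^ 2 ∂μ)).eq_or_lt with hs | hs
  · rw [← hs]; exact hI0
  · refine le_of_mul_le_mul_left ?_ hs
    calc Real.sqrt (∫ x, (∫ y, F y x ∂ν) ^ 2 ∂μ) * Real.sqrt (∫ x, (∫ y, F y x ∂ν) ^ 2 ∂μ)
        = ∫ x, (∫ y, F y x ∂ν) ^ 2 ∂μ := Real.mul_self_sqrt hA0
      _ ≤ _ := hmain

/-! ### The stub -/

/-- **`stub_minkowskiInTime`** (fixed `N`, bookkeeping; Minkowski's integral inequality for the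
forecast curve `t ↦ P_tJ_tot` in `L²(μ_T)`): for `0 ≤ A ≤ S`, if `t ↦ √A_N(t)` is integrable on `(A,S]`
then `√(∫ (u_S − u_A)² dμ_T) ≤ ∫_{(A,S]} √A_N(t) dt`, `u_S = ∫_{(0,S]} P_tJ_tot dt`,
`A_N(t) = ‖P_tJ_tot‖²_{L²(μ_T)}`. Proof: `u_S − u_A = ∫_{(A,S]} P_tJ dt` pointwise
(`centred_integrableOn_act`), then `sqrt_integral_sq_integral_le` with the dominator
`(|μ_T J| + KC) e^{H/(4T)} ∈ L²(μ_T)` (`pinnedChain_abs_act_le`, `pinnedChain_harris_bound`);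
`N = 0`: `J ≡ 0`. [folklore] -/
theorem stub_minkowskiInTime :
    ∀ ω₂ lam β γ : ℝ, 0 < ω₂ → 0 < lam → 0 < β → 0 < γ → ∀ T : ℝ, 0 < T → ∀ (N : ℕ) (A S : ℝ),
      0 ≤ A → A ≤ S →
      MeasureTheory.IntegrableOn
          (fun t : ℝ => Real.sqrt (Literature.MathematicalPhysics.KineticTheory.OddSectorLocality.forecastNormSq ω₂ lam β γ T N t))
          (Set.Ioc A S) →
      Real.sqrt (∫ x, ((∫ t in Set.Ioc (0 : ℝ) S,
            Literature.MathematicalPhysics.KineticTheory.OddSectorLocality.currentForecast ω₂ lam β γ T N t x) -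
          ∫ t in Set.Ioc (0 : ℝ) A,
            Literature.MathematicalPhysics.KineticTheory.OddSectorLocality.currentForecast ω₂ lam β γ T N t x) ^ 2
        ∂(Literature.MathematicalPhysics.KineticTheory.OddSectorLocality.gibbsWeight ω₂ lam β γ T N)) ≤
      ∫ t in Set.Ioc A S,
        Real.sqrt (Literature.MathematicalPhysics.KineticTheory.OddSectorLocality.forecastNormSq ω₂ lam β γ T N t) := by
  intro ω₂ lam β γ hω hl hβ hγ T hT N A S hA hAS hint
  rcases Nat.eq_zero_or_pos N with rfl | hN
  · -- `N = 0`: `J ≡ 0`, both correctors vanish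
    have hI0 : 0 ≤ ∫ t in Ioc A S, Real.sqrt (forecastNormSq ω₂ lam β γ T 0 t) :=
      integral_nonneg fun t => Real.sqrt_nonneg _
    have h0 : ∀ (t : ℝ) (x : PhaseSpace 0), currentForecast ω₂ lam β γ T 0 t x = 0 := fun t x => by
      simp only [currentForecast, Finset.univ_eq_empty, Finset.sum_empty, integral_zero]
    have hL : Real.sqrt (∫ x, ((∫ t in Ioc (0 : ℝ) S, currentForecast ω₂ lam β γ T 0 t x) -
        ∫ t in Ioc (0 : ℝ) A, currentForecast ω₂ lam β γ T 0 t x) ^ 2 ∂(gibbsWeight ω₂ lam β γ T 0)) =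
        0 := by
      simp [h0]
    exact hL.trans_le hI0
  -- `N ≥ 1`: Harris constants at `ϑ = 1/(4T)`
  obtain ⟨hϑ0, h2ϑ⟩ := quarter_inv_temp_admissible hT
  generalize hϑ : 1 / (4 * T) = ϑ at hϑ0 h2ϑ
  have hϑ1 : ϑ < 1 / T := by linarith
  obtain ⟨K, c, hK, hc, hb⟩ := pinnedChain_harris_bound hω hl.le hβ hγ hN hT hϑ0 hϑ1
  have hJc := continuous_totalBondCurrent ω₂ lam β γ N
  have hJb := abs_totalBondCurrent_le_exp hω.le hl.le hβ.le γ N hϑ0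
  have hJ0 := integral_totalBondCurrent_gibbsMeasure hω hl.le hβ.le γ N hT
  have hC : (0 : ℝ) ≤ N * (N * ((3 + β) / 2) * (2 * Real.exp ϑ / ϑ ^ 2)) := by
    have := hβ.le
    positivity
  -- the weight `μ_T = Z • gibbsMeasure` is a finite measure
  have hμ : gibbsWeight ω₂ lam β γ T N =
      (pinnedChain ω₂ lam β γ).partitionFunction N T • (pinnedChain ω₂ lam β γ).gibbsMeasure N T :=
    withDensity_exp_neg_hamiltonian_eq_smul_gibbsMeasure hω hl.le hβ.le γ N hT
  have hZtop := (pinnedChain ω₂ lam β γ).partitionFunction_ne_top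
    (pinnedChain_integrable_gibbsDensity hω hl.le hβ.le γ N hT)
  haveI := pinnedChain_isProbabilityMeasure_gibbsMeasure hω hl.le hβ.le γ N hT
  haveI : IsFiniteMeasure (gibbsWeight ω₂ lam β γ T N) := by
    rw [hμ]
    exact ⟨by rw [Measure.smul_apply, smul_eq_mul, measure_univ, mul_one]; exact hZtop.lt_top⟩
  -- joint measurability and the `t`-uniform weighted bound of the forecast, `L²` dominator
  have hFmeas : StronglyMeasurable (Function.uncurry (currentForecast ω₂ lam β γ T N)) :=
    pinnedChain_stronglyMeasurable_act_uncurry hω hl.le hβ.le hγ.le T T hJc.measurable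
  obtain ⟨M, hFB⟩ : ∃ M : ℝ, ∀ (t : ℝ) (x : PhaseSpace N), |currentForecast ω₂ lam β γ T N t x| ≤
      M * Real.exp (ϑ * (pinnedChain ω₂ lam β γ).hamiltonian N x) :=
    ⟨_, fun t x => pinnedChain_abs_act_le hω hl.le hβ hϑ0 hb hc hJc hC hJb x t.toNNReal⟩
  have hBmem : MemLp (fun x : PhaseSpace N => M * Real.exp (ϑ * (pinnedChain ω₂ lam β γ).hamiltonian N x))
      2 (gibbsWeight ω₂ lam β γ T N) := by
    rw [hμ]
    refine MemLp.smul_measure ?_ hZtop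
    have hcont : Continuous fun x : PhaseSpace N =>
        M * Real.exp (ϑ * (pinnedChain ω₂ lam β γ).hamiltonian N x) :=
      continuous_const.mul (Real.continuous_exp.comp
        (continuous_const.mul (pinnedChain_continuous_hamiltonian ω₂ lam β γ N)))
    rw [memLp_two_iff_integrable_sq hcont.aestronglyMeasurable]
    refine ((pinnedChain_integrable_exp_mul_hamiltonian_gibbsMeasure hω hl.le hβ.le γ N hT
      h2ϑ).const_mul (M ^ 2)).congr (Eventually.of_forall fun x => ?_)
    have e : (M * Real.exp (ϑ * (pinnedChain ω₂ lam β γ).hamiltonian N x)) ^ 2 =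
        M ^ 2 * Real.exp (2 * ϑ * (pinnedChain ω₂ lam β γ).hamiltonian N x) := by
      rw [mul_pow, sq (Real.exp _), ← Real.exp_add]; congr 1; ring_nf
    exact e.symm
  -- `u_S − u_A = ∫_{(A,S]} P_tJ dt` pointwise
  have hsplit : ∀ x : PhaseSpace N,
      (∫ t in Ioc (0 : ℝ) S, currentForecast ω₂ lam β γ T N t x) -
          ∫ t in Ioc (0 : ℝ) A, currentForecast ω₂ lam β γ T N t x =
        ∫ t in Ioc A S, currentForecast ω₂ lam β γ T N t x := fun x => by
    have hIoi : IntegrableOn (fun t : ℝ => currentForecast ω₂ lam β γ T N t x) (Ioi 0) :=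
      centred_integrableOn_act hK.le hb hc hJc hC hJb hJ0 hω hl.le hβ.le hγ.le x
    rw [sub_eq_iff_eq_add', ← setIntegral_union (Ioc_disjoint_Ioc_of_le le_rfl) measurableSet_Ioc
      (hIoi.mono_set Ioc_subset_Ioi_self)
      (hIoi.mono_set (Ioc_subset_Ioi_self.trans (Ioi_subset_Ioi hA))), Ioc_union_Ioc_eq_Ioc hA hAS]
  have hcongr : ∫ x, ((∫ t in Ioc (0 : ℝ) S, currentForecast ω₂ lam β γ T N t x) -
        ∫ t in Ioc (0 : ℝ) A, currentForecast ω₂ lam β γ T N t x) ^ 2 ∂(gibbsWeight ω₂ lam β γ T N) =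
      ∫ x, (∫ t in Ioc A S, currentForecast ω₂ lam β γ T N t x) ^ 2 ∂(gibbsWeight ω₂ lam β γ T N) :=
    integral_congr_ae (Eventually.of_forall fun x => congrArg (fun r : ℝ => r ^ 2) (hsplit x))
  rw [hcongr]
  exact sqrt_integral_sq_integral_le (ν := volume.restrict (Ioc A S)) hFmeas hBmem hFB hint

end Summit.AtomisticToContinuum.FouriersLaw.Theorems.OddSectorIrreversibility
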